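import Mathlib
import Summits.Ventures.FusionMHD.Models.SAlphaSecondStableS25A525PointPrep
import HarnessLib

/-!
# F3 row «F3.BALLOON-sα-SECOND-STABILITY-S5o2-A525»: at `(s, α) = (5/2, 21/4)` — ABOVE the unstable band at shear `5/2` — the `s–α` ballooning MODEL is on the STABLE SIDE again (`SAlpha.StableSide (5/2) (21/4)`): the first kernel-certified SECOND-STABILITY point at shear `5/2`; with gridfusion-lit-3's `Bench/SAlphaS25W48.unstableWitness_49` (`49/10 ∈ U_{5/2}`, ★ #285) the SECOND stability edge at `s = 5/2` lies in the CLOSED interval `[49/10, 21/4]` (width `7/20`) — the first two-sided second-edge bracket at a shear other than `3`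

LADDER-GRIDFUSION rung F3 (cell `gridfusion`; DIRECTOR RULING 67 (5): «a second-stability-side theorem (stable again at large α at fixed s)»
is a row class outside the eight-shear cap; ★ #284 «S3-SECOND-EDGE-BRACKET» is the `s = 3` instance).  Assembly by gridfusion-model-7 g10, 2026-08-28, in
model-7 g8's multi-piece CORE LANE exactly as g9's `SAlphaSecondStableS3A6*` / `SAlphaSecondStableS3A575*` (generator HOME/models/model-7/g9/stable2/,
design `design36.py 2.5 5.25 … 8 24`): (i) FOURTEEN kernel-certified core amplitude pieces `SAlphaSecondStableS25A525Core0…13` (polynomials `H0…H13` on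
`[0,1/2] ∪ [1/2,1] ∪ [1,3/2] ∪ [3/2,7/4] ∪ [7/4,2] ∪ [2,5/2] ∪ [5/2,3] ∪ [3,4] ∪ [4,6] ∪ [6,10] ∪ [10,14] ∪ [14,17] ∪ [17,20] ∪ [20,24]`, degrees ≤ 33,
the first EVEN; Taylor-model POSITIVITY leaves of half-width `1/32` on `[0, 3]`, `1/16` on `[3, 24]` deciding `F_k > 0` and
`amplitudeResidual (5/2) (21/4) F_k F_k″ ≤ 0` piece by piece; slacks `η_k = 0.0008 … 0.00145` increasing to the right; trig point values with 20 terms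
after 5 halvings since `θ ≤ 24`), and (ii) gridfusion-lit-4's engine `Literature/MathematicalPhysics/MHD/BallooningSAlphaStableSide.lean`
(`energyDominatesOn_of_amplitude`, `EnergyDominatesOn.glue`, the explicit tail `(1 − c/θ)(1 + (α/s²) cos θ/θ²)` with `energyDominatesOn_tail` /
`tail_logDeriv_le` at `(c, T) = (8, 24)` — side condition `tailBound (5/2) (21/4) 8 24 ≥ 0` by `norm_num` (at `α/s² = 21/25` lit-4's tail majorant
needs `T ≥ 23` for `c = 8`; the junction `c/(T(T−c)) + (α/s²)(T+2)/(T(T²−α/s²)) = 0.02241… ≤ F′(24)/F(24) = 0.03538…` exact) —,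
`stableSide_of_core_tail`).  The 28-statement program `ss25525Prog` carries the shear (`Λ = (5/2)t − (21/4) sin t`, `Λ′ = 5/2 − (21/4) cos t`); its top
register is PROVED `= −amplitudeResidual (5/2) (21/4) F F″`.  Junctions `1/2, 1, 3/2, 7/4, 2, 5/2, 3, 4, 6, 10, 14, 17, 20` and the tail junction `24` are
exact-rational inequalities (log-derivative drops `≥ 1.7e-5`); `F₀′(0) = 0` exactly.  0 kit in the kernel objects; no `native_decide`.

## THREE COLUMNS
CERTIFIED: in the `s–α` ballooning MODEL (Freidberg (12.96)–(12.99), `Λ = sθ − α sin θ`, `θ₀ = 0`) at `(s, α) = (5/2, 21/4)`: for EVERY window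
`[a, b]` and every trial function `X` differentiable on `[a, b]` with `X(a) = X(b) = 0` there is NO `SAlpha.UnstableWitness`
(`stableSide_fiveHalves_525`) — the surface is on the stable side although it lies ABOVE the certified-unstable surfaces of the same shear: with
gridfusion-lit-3's `Summit.Ventures.FusionMHD.Bench.SAlphaS25W48.unstableWitness_49` (`(5/2, 49/10)` unstable; ★ #285's band `U_{5/2} ⊇ [7/4, 49/10]` with
★ #250's lens and model-7's `SAlphaPolyWitnessS25A48`, `24/5`) the MODEL's SECOND stability boundary at `s = 5/2`, `sup {α ≤ 21/4 : α ∈ U_{5/2}}`, lies in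
the CLOSED interval `[49/10, 21/4]` (width `7/20`); monotonicity / connectedness of the unstable set in `α` is NOT typed.  VALIDATED (not in the kernel):
E–L shooting (model-7 g9 kit j304843, even and odd solutions, zero on `(0, 150]`) puts the second edge at `α ≈ 4.91` for `s = 5/2` (lit-3 `edges.py`:
`4.907`); Freidberg Fig. 12.5 shows the second-stable region qualitatively; float Liouville amplitude: `F′/F(24) ≈ 0.0354`, `min F = 0.605` near
`θ ≈ 1.8`, `F(24) ≈ 118·F(0)`, slack margins `E/((1+Λ²)²F) ≤ −η_k`.  MODELLED: `s–α` model (large-aspect-ratio shifted circles, high-`n` ballooning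
ordering, `θ₀ = 0`, ideal MHD); «stable side» = the MODEL's one-surface functional admits no negative compactly supported trial function (lit-3's witness
class); the representation step (Connor–Hastie–Taylor 1979) is quoted in the Literature file, not typed; in particular NOTHING is claimed about `θ₀ ≠ 0`
(the physical second-stability access question involves all `θ₀`), about a device, or about a `β`-limit.
Citations: Freidberg 2014 §12.3, §12.6.2 (12.96)–(12.100), Fig. 12.5 [Freidberg2014]; Hartman 2002 XI.6.2 [Hartman2002]; Makino–Berz 2003 Alg. 2
[MakinoBerz2003].  Everything below is [instance data].
-/

open Literature.Analysis.ValidatedNumerics Literature.Analysis.ValidatedNumerics.PolyMP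
open Literature.Analysis.ValidatedNumerics.NumericsMP Literature.Analysis.ValidatedNumerics.ExpPoly
open Literature.MathematicalPhysics.MHD.Ballooning
open Real Set

namespace Summit.Ventures.FusionMHD.Models

namespace SAlphaSecondStableS25A525

/-! (PART 2/2: §2 the junction inequalities + tail facts, §3 the assembly; §1 lives in `SAlphaSecondStableS25A525PointPrep`.) -/

/-! ### §2 The junctions (log-derivative drops) -/

/-- Junction at `1/2`: `F_1′/F_1 ≤ F_0′/F_0` there (the phase drops). [instance data] -/
theorem ss25525_junction01 : (SAlpha.amplitudePhase (5 / 2) (21 / 4) (Poly.eval H1) (Poly.eval (Poly.deriv H1))) (1 / 2 : ℝ) ≤ (SAlpha.amplitudePhase (5 / 2) (21 / 4) (Poly.eval H0) (Poly.eval (Poly.deriv H0))) (1 / 2 : ℝ) := by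
  rw [SAlpha.amplitudePhase_le_iff, ← deriv_H1, ← deriv_H0, H1_at_a, H1d_at_a, H0_at_b, H0d_at_b]
  norm_num

/-- Junction at `1`: `F_2′/F_2 ≤ F_1′/F_1` there (the phase drops). [instance data] -/
theorem ss25525_junction12 : (SAlpha.amplitudePhase (5 / 2) (21 / 4) (Poly.eval H2) (Poly.eval (Poly.deriv H2))) (1 : ℝ) ≤ (SAlpha.amplitudePhase (5 / 2) (21 / 4) (Poly.eval H1) (Poly.eval (Poly.deriv H1))) (1 : ℝ) := by
  rw [SAlpha.amplitudePhase_le_iff, ← deriv_H2, ← deriv_H1, H2_at_a, H2d_at_a, H1_at_b, H1d_at_b]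
  norm_num

/-- Junction at `3/2`: `F_3′/F_3 ≤ F_2′/F_2` there (the phase drops). [instance data] -/
theorem ss25525_junction23 : (SAlpha.amplitudePhase (5 / 2) (21 / 4) (Poly.eval H3) (Poly.eval (Poly.deriv H3))) (3 / 2 : ℝ) ≤ (SAlpha.amplitudePhase (5 / 2) (21 / 4) (Poly.eval H2) (Poly.eval (Poly.deriv H2))) (3 / 2 : ℝ) := by
  rw [SAlpha.amplitudePhase_le_iff, ← deriv_H3, ← deriv_H2, H3_at_a, H3d_at_a, H2_at_b, H2d_at_b]
  norm_num

/-- Junction at `7/4`: `F_4′/F_4 ≤ F_3′/F_3` there (the phase drops). [instance data] -/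
theorem ss25525_junction34 : (SAlpha.amplitudePhase (5 / 2) (21 / 4) (Poly.eval H4) (Poly.eval (Poly.deriv H4))) (7 / 4 : ℝ) ≤ (SAlpha.amplitudePhase (5 / 2) (21 / 4) (Poly.eval H3) (Poly.eval (Poly.deriv H3))) (7 / 4 : ℝ) := by
  rw [SAlpha.amplitudePhase_le_iff, ← deriv_H4, ← deriv_H3, H4_at_a, H4d_at_a, H3_at_b, H3d_at_b]
  norm_num

/-- Junction at `2`: `F_5′/F_5 ≤ F_4′/F_4` there (the phase drops). [instance data] -/
theorem ss25525_junction45 : (SAlpha.amplitudePhase (5 / 2) (21 / 4) (Poly.eval H5) (Poly.eval (Poly.deriv H5))) (2 : ℝ) ≤ (SAlpha.amplitudePhase (5 / 2) (21 / 4) (Poly.eval H4) (Poly.eval (Poly.deriv H4))) (2 : ℝ) := by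
  rw [SAlpha.amplitudePhase_le_iff, ← deriv_H5, ← deriv_H4, H5_at_a, H5d_at_a, H4_at_b, H4d_at_b]
  norm_num

/-- Junction at `5/2`: `F_6′/F_6 ≤ F_5′/F_5` there (the phase drops). [instance data] -/
theorem ss25525_junction56 : (SAlpha.amplitudePhase (5 / 2) (21 / 4) (Poly.eval H6) (Poly.eval (Poly.deriv H6))) (5 / 2 : ℝ) ≤ (SAlpha.amplitudePhase (5 / 2) (21 / 4) (Poly.eval H5) (Poly.eval (Poly.deriv H5))) (5 / 2 : ℝ) := by
  rw [SAlpha.amplitudePhase_le_iff, ← deriv_H6, ← deriv_H5, H6_at_a, H6d_at_a, H5_at_b, H5d_at_b]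
  norm_num

/-- Junction at `3`: `F_7′/F_7 ≤ F_6′/F_6` there (the phase drops). [instance data] -/
theorem ss25525_junction67 : (SAlpha.amplitudePhase (5 / 2) (21 / 4) (Poly.eval H7) (Poly.eval (Poly.deriv H7))) (3 : ℝ) ≤ (SAlpha.amplitudePhase (5 / 2) (21 / 4) (Poly.eval H6) (Poly.eval (Poly.deriv H6))) (3 : ℝ) := by
  rw [SAlpha.amplitudePhase_le_iff, ← deriv_H7, ← deriv_H6, H7_at_a, H7d_at_a, H6_at_b, H6d_at_b]
  norm_num

/-- Junction at `4`: `F_8′/F_8 ≤ F_7′/F_7` there (the phase drops). [instance data] -/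
theorem ss25525_junction78 : (SAlpha.amplitudePhase (5 / 2) (21 / 4) (Poly.eval H8) (Poly.eval (Poly.deriv H8))) (4 : ℝ) ≤ (SAlpha.amplitudePhase (5 / 2) (21 / 4) (Poly.eval H7) (Poly.eval (Poly.deriv H7))) (4 : ℝ) := by
  rw [SAlpha.amplitudePhase_le_iff, ← deriv_H8, ← deriv_H7, H8_at_a, H8d_at_a, H7_at_b, H7d_at_b]
  norm_num

/-- Junction at `6`: `F_9′/F_9 ≤ F_8′/F_8` there (the phase drops). [instance data] -/
theorem ss25525_junction89 : (SAlpha.amplitudePhase (5 / 2) (21 / 4) (Poly.eval H9) (Poly.eval (Poly.deriv H9))) (6 : ℝ) ≤ (SAlpha.amplitudePhase (5 / 2) (21 / 4) (Poly.eval H8) (Poly.eval (Poly.deriv H8))) (6 : ℝ) := by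
  rw [SAlpha.amplitudePhase_le_iff, ← deriv_H9, ← deriv_H8, H9_at_a, H9d_at_a, H8_at_b, H8d_at_b]
  norm_num

/-- Junction at `10`: `F_10′/F_10 ≤ F_9′/F_9` there (the phase drops). [instance data] -/
theorem ss25525_junction910 : (SAlpha.amplitudePhase (5 / 2) (21 / 4) (Poly.eval H10) (Poly.eval (Poly.deriv H10))) (10 : ℝ) ≤ (SAlpha.amplitudePhase (5 / 2) (21 / 4) (Poly.eval H9) (Poly.eval (Poly.deriv H9))) (10 : ℝ) := by
  rw [SAlpha.amplitudePhase_le_iff, ← deriv_H10, ← deriv_H9, H10_at_a, H10d_at_a, H9_at_b, H9d_at_b]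
  norm_num

/-- Junction at `14`: `F_11′/F_11 ≤ F_10′/F_10` there (the phase drops). [instance data] -/
theorem ss25525_junction1011 : (SAlpha.amplitudePhase (5 / 2) (21 / 4) (Poly.eval H11) (Poly.eval (Poly.deriv H11))) (14 : ℝ) ≤ (SAlpha.amplitudePhase (5 / 2) (21 / 4) (Poly.eval H10) (Poly.eval (Poly.deriv H10))) (14 : ℝ) := by
  rw [SAlpha.amplitudePhase_le_iff, ← deriv_H11, ← deriv_H10, H11_at_a, H11d_at_a, H10_at_b, H10d_at_b]
  norm_num

/-- Junction at `17`: `F_12′/F_12 ≤ F_11′/F_11` there (the phase drops). [instance data] -/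
theorem ss25525_junction1112 : (SAlpha.amplitudePhase (5 / 2) (21 / 4) (Poly.eval H12) (Poly.eval (Poly.deriv H12))) (17 : ℝ) ≤ (SAlpha.amplitudePhase (5 / 2) (21 / 4) (Poly.eval H11) (Poly.eval (Poly.deriv H11))) (17 : ℝ) := by
  rw [SAlpha.amplitudePhase_le_iff, ← deriv_H12, ← deriv_H11, H12_at_a, H12d_at_a, H11_at_b, H11d_at_b]
  norm_num

/-- Junction at `20`: `F_13′/F_13 ≤ F_12′/F_12` there (the phase drops). [instance data] -/
theorem ss25525_junction1213 : (SAlpha.amplitudePhase (5 / 2) (21 / 4) (Poly.eval H13) (Poly.eval (Poly.deriv H13))) (20 : ℝ) ≤ (SAlpha.amplitudePhase (5 / 2) (21 / 4) (Poly.eval H12) (Poly.eval (Poly.deriv H12))) (20 : ℝ) := by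
  rw [SAlpha.amplitudePhase_le_iff, ← deriv_H13, ← deriv_H12, H13_at_a, H13d_at_a, H12_at_b, H12d_at_b]
  norm_num

/-- Tail junction at `24`: the tail's bound `c/(T(T − c)) + α(T + 2)/(T(T² − α)) = 1719/76688` (`c = 8`) is below `F′(T)/F(T)` of the last piece. [instance data] -/
theorem ss25525_junction_tail :
    (8 : ℝ) / ((24 : ℝ) * ((24 : ℝ) - (8 : ℝ))) + (21 / 4 : ℝ) / (5 / 2 : ℝ) ^ 2 * ((24 : ℝ) + 2) / ((24 : ℝ) * ((24 : ℝ) ^ 2 - (21 / 4 : ℝ) / (5 / 2 : ℝ) ^ 2))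
      ≤ Poly.eval (Poly.deriv H13) (24 : ℝ) / Poly.eval H13 (24 : ℝ) := by
  rw [← deriv_H13, H13_at_b, H13d_at_b]
  norm_num

/-- The tail side condition `tailBound (5 / 2) (21/4) 8 24 ≥ 0` of lit-4's explicit tail amplitude. [instance data] -/
theorem ss25525_tailBound_nonneg : 0 ≤ SAlpha.tailBound (5 / 2) (21 / 4) (8 : ℝ) (24 : ℝ) := by
  norm_num [SAlpha.tailBound, SAlpha.tailMajorant, SAlpha.tailMaj7, SAlpha.tailMaj6, SAlpha.tailMaj5, SAlpha.tailMaj4,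
    SAlpha.tailMaj3, SAlpha.tailMaj2, SAlpha.tailMaj1]

/-! ### §3 Assembly -/

/-- The glued core phase on `[0, 24]` dominates the energy. [instance data] -/
theorem ss25525_dominates_core :
    SAlpha.EnergyDominatesOn (5 / 2) (21 / 4) (fun θ => if θ ≤ (20 : ℝ) then (if θ ≤ (17 : ℝ) then (if θ ≤ (14 : ℝ) then (if θ ≤ (10 : ℝ) then (if θ ≤ (6 : ℝ) then (if θ ≤ (4 : ℝ) then (if θ ≤ (3 : ℝ) then (if θ ≤ (5 / 2 : ℝ) then (if θ ≤ (2 : ℝ) then (if θ ≤ (7 / 4 : ℝ) then (if θ ≤ (3 / 2 : ℝ) then (if θ ≤ (1 : ℝ) then (if θ ≤ (1 / 2 : ℝ) then ((SAlpha.amplitudePhase (5 / 2) (21 / 4) (Poly.eval H0) (Poly.eval (Poly.deriv H0))) θ) else (SAlpha.amplitudePhase (5 / 2) (21 / 4) (Poly.eval H1) (Poly.eval (Poly.deriv H1))) θ) else (SAlpha.amplitudePhase (5 / 2) (21 / 4) (Poly.eval H2) (Poly.eval (Poly.deriv H2))) θ) else (SAlpha.amplitudePhase (5 / 2) (21 /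 4) (Poly.eval H3) (Poly.eval (Poly.deriv H3))) θ) else (SAlpha.amplitudePhase (5 / 2) (21 / 4) (Poly.eval H4) (Poly.eval (Poly.deriv H4))) θ) else (SAlpha.amplitudePhase (5 / 2) (21 / 4) (Poly.eval H5) (Poly.eval (Poly.deriv H5))) θ) else (SAlpha.amplitudePhase (5 / 2) (21 / 4) (Poly.eval H6) (Poly.eval (Poly.deriv H6))) θ) else (SAlpha.amplitudePhase (5 / 2) (21 / 4) (Poly.eval H7) (Poly.eval (Poly.deriv H7))) θ) else (SAlpha.amplitudePhase (5 / 2) (21 / 4) (Poly.eval H8) (Poly.eval (Poly.deriv H8))) θ) else (SAlpha.amplitudePhase (5 / 2) (21 / 4) (Poly.eval H9) (Poly.eval (Poly.deriv H9))) θ) else (SAlpha.amplitudePhase (5 / 2) (21 / 4) (Poly.eval H10) (Poly.eval (Poly.deriv H10))) θ) else (SAlpha.amplitudePhase (5 / 2) (21 / 4) (Poly.eval H11) (Poly.eval (Poly.deriv H11))) θ) else (SAlpha.amplitudePhase (5 / 2) (21 / 4) (Poly.eval H12) (Poly.eval (Poly.deriv H12))) θ) else (SAlpha.amplitudePhase (5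 / 2) (21 / 4) (Poly.eval H13) (Poly.eval (Poly.deriv H13))) θ) (Icc 0 (24 : ℝ)) := by
  have h0 := ss25525_dominates0
  have h1 := ss25525_dominates1
  have h2 := ss25525_dominates2
  have h3 := ss25525_dominates3
  have h4 := ss25525_dominates4
  have h5 := ss25525_dominates5
  have h6 := ss25525_dominates6
  have h7 := ss25525_dominates7
  have h8 := ss25525_dominates8
  have h9 := ss25525_dominates9
  have h10 := ss25525_dominates10
  have h11 := ss25525_dominates11
  have h12 := ss25525_dominates12
  have h13 := ss25525_dominates13
  have g1 : SAlpha.EnergyDominatesOn (5 / 2) (21 / 4) (fun θ => if θ ≤ (1 / 2 : ℝ) then ((SAlpha.amplitudePhase (5 / 2) (21 / 4) (Poly.eval H0) (Poly.eval (Poly.deriv H0))) θ) else (SAlpha.amplitudePhase (5 / 2) (21 / 4) (Poly.eval H1) (Poly.eval (Poly.deriv H1))) θ) (Icc 0 (1 : ℝ)) := by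
    refine SAlpha.EnergyDominatesOn.glue (h0.mono ?_) (h1.mono ?_) ?_
    · intro θ hθ; exact ⟨hθ.1.1, hθ.2⟩
    · intro θ hθ; exact ⟨hθ.2, hθ.1.2⟩
    · exact ss25525_junction01
  have g2 : SAlpha.EnergyDominatesOn (5 / 2) (21 / 4) (fun θ => if θ ≤ (1 : ℝ) then (if θ ≤ (1 / 2 : ℝ) then ((SAlpha.amplitudePhase (5 / 2) (21 / 4) (Poly.eval H0) (Poly.eval (Poly.deriv H0))) θ) else (SAlpha.amplitudePhase (5 / 2) (21 / 4) (Poly.eval H1) (Poly.eval (Poly.deriv H1))) θ) else (SAlpha.amplitudePhase (5 / 2) (21 / 4) (Poly.eval H2) (Poly.eval (Poly.deriv H2))) θ) (Icc 0 (3 / 2 : ℝ)) := by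
    refine SAlpha.EnergyDominatesOn.glue (g1.mono ?_) (h2.mono ?_) ?_
    · intro θ hθ; exact ⟨hθ.1.1, hθ.2⟩
    · intro θ hθ; exact ⟨hθ.2, hθ.1.2⟩
    · have hn1 : ¬ ((1 : ℝ) ≤ (1 / 2 : ℝ)) := by norm_num
      simp only [hn1, if_false]
      exact ss25525_junction12
  have g3 : SAlpha.EnergyDominatesOn (5 / 2) (21 / 4) (fun θ => if θ ≤ (3 / 2 : ℝ) then (if θ ≤ (1 : ℝ) then (if θ ≤ (1 / 2 : ℝ) then ((SAlpha.amplitudePhase (5 / 2) (21 / 4) (Poly.eval H0) (Poly.eval (Poly.deriv H0))) θ) else (SAlpha.amplitudePhase (5 / 2) (21 / 4) (Poly.eval H1) (Poly.eval (Poly.deriv H1))) θ) else (SAlpha.amplitudePhase (5 / 2) (21 / 4) (Poly.eval H2) (Poly.eval (Poly.deriv H2))) θ) else (SAlpha.amplitudePhase (5 / 2) (21 / 4) (Poly.eval H3) (Poly.eval (Poly.deriv H3))) θ) (Icc 0 (7 / 4 : ℝ)) := by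
    refine SAlpha.EnergyDominatesOn.glue (g2.mono ?_) (h3.mono ?_) ?_
    · intro θ hθ; exact ⟨hθ.1.1, hθ.2⟩
    · intro θ hθ; exact ⟨hθ.2, hθ.1.2⟩
    · have hn1 : ¬ ((3 / 2 : ℝ) ≤ (1 / 2 : ℝ)) := by norm_num
      have hn2 : ¬ ((3 / 2 : ℝ) ≤ (1 : ℝ)) := by norm_num
      simp only [hn1, hn2, if_false]
      exact ss25525_junction23
  have g4 : SAlpha.EnergyDominatesOn (5 / 2) (21 / 4) (fun θ => if θ ≤ (7 / 4 : ℝ) then (if θ ≤ (3 / 2 : ℝ) then (if θ ≤ (1 : ℝ) then (if θ ≤ (1 / 2 : ℝ) then ((SAlpha.amplitudePhase (5 / 2) (21 / 4) (Poly.eval H0) (Poly.eval (Poly.deriv H0))) θ) else (SAlpha.amplitudePhase (5 / 2) (21 / 4) (Poly.eval H1) (Poly.eval (Poly.deriv H1))) θ) else (SAlpha.amplitudePhase (5 / 2) (21 / 4) (Poly.eval H2) (Poly.eval (Poly.deriv H2))) θ) else (SAlpha.amplitudePhase (5 / 2) (21 / 4) (Poly.eval H3) (Poly.eval (Poly.deriv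 H3))) θ) else (SAlpha.amplitudePhase (5 / 2) (21 / 4) (Poly.eval H4) (Poly.eval (Poly.deriv H4))) θ) (Icc 0 (2 : ℝ)) := by
    refine SAlpha.EnergyDominatesOn.glue (g3.mono ?_) (h4.mono ?_) ?_
    · intro θ hθ; exact ⟨hθ.1.1, hθ.2⟩
    · intro θ hθ; exact ⟨hθ.2, hθ.1.2⟩
    · have hn1 : ¬ ((7 / 4 : ℝ) ≤ (1 / 2 : ℝ)) := by norm_num
      have hn2 : ¬ ((7 / 4 : ℝ) ≤ (1 : ℝ)) := by norm_num
      have hn3 : ¬ ((7 / 4 : ℝ) ≤ (3 / 2 : ℝ)) := by norm_num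
      simp only [hn1, hn2, hn3, if_false]
      exact ss25525_junction34
  have g5 : SAlpha.EnergyDominatesOn (5 / 2) (21 / 4) (fun θ => if θ ≤ (2 : ℝ) then (if θ ≤ (7 / 4 : ℝ) then (if θ ≤ (3 / 2 : ℝ) then (if θ ≤ (1 : ℝ) then (if θ ≤ (1 / 2 : ℝ) then ((SAlpha.amplitudePhase (5 / 2) (21 / 4) (Poly.eval H0) (Poly.eval (Poly.deriv H0))) θ) else (SAlpha.amplitudePhase (5 / 2) (21 / 4) (Poly.eval H1) (Poly.eval (Poly.deriv H1))) θ) else (SAlpha.amplitudePhase (5 / 2) (21 / 4) (Poly.eval H2) (Poly.eval (Poly.deriv H2))) θ) else (SAlpha.amplitudePhase (5 / 2) (21 / 4) (Poly.eval H3) (Poly.eval (Poly.deriv H3))) θ) else (SAlpha.amplitudePhase (5 / 2) (21 / 4) (Poly.eval H4) (Poly.eval (Poly.deriv H4))) θ) else (SAlpha.amplitudePhase (5 / 2) (21 / 4) (Poly.eval H5) (Poly.eval (Poly.deriv H5))) θ) (Icc 0 (5 / 2 : ℝ)) := by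
    refine SAlpha.EnergyDominatesOn.glue (g4.mono ?_) (h5.mono ?_) ?_
    · intro θ hθ; exact ⟨hθ.1.1, hθ.2⟩
    · intro θ hθ; exact ⟨hθ.2, hθ.1.2⟩
    · have hn1 : ¬ ((2 : ℝ) ≤ (1 / 2 : ℝ)) := by norm_num
      have hn2 : ¬ ((2 : ℝ) ≤ (1 : ℝ)) := by norm_num
      have hn3 : ¬ ((2 : ℝ) ≤ (3 / 2 : ℝ)) := by norm_num
      have hn4 : ¬ ((2 : ℝ) ≤ (7 / 4 : ℝ)) := by norm_num
      simp only [hn1, hn2, hn3, hn4, if_false]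
      exact ss25525_junction45
  have g6 : SAlpha.EnergyDominatesOn (5 / 2) (21 / 4) (fun θ => if θ ≤ (5 / 2 : ℝ) then (if θ ≤ (2 : ℝ) then (if θ ≤ (7 / 4 : ℝ) then (if θ ≤ (3 / 2 : ℝ) then (if θ ≤ (1 : ℝ) then (if θ ≤ (1 / 2 : ℝ) then ((SAlpha.amplitudePhase (5 / 2) (21 / 4) (Poly.eval H0) (Poly.eval (Poly.deriv H0))) θ) else (SAlpha.amplitudePhase (5 / 2) (21 / 4) (Poly.eval H1) (Poly.eval (Poly.deriv H1))) θ) else (SAlpha.amplitudePhase (5 / 2) (21 / 4) (Poly.eval H2) (Poly.eval (Poly.deriv H2))) θ) else (SAlpha.amplitudePhase (5 / 2) (21 / 4) (Poly.eval H3) (Poly.eval (Poly.deriv H3))) θ) else (SAlpha.amplitudePhase (5 / 2) (21 / 4) (Poly.eval H4) (Poly.eval (Poly.deriv H4))) θ) else (SAlpha.amplitudePhase (5 / 2) (21 / 4) (Poly.eval H5) (Poly.eval (Poly.deriv H5))) θ) else (SAlpha.amplitudePhase (5 / 2) (21 / 4) (Poly.eval H6) (Poly.eval (Poly.deriv H6)))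 θ) (Icc 0 (3 : ℝ)) := by
    refine SAlpha.EnergyDominatesOn.glue (g5.mono ?_) (h6.mono ?_) ?_
    · intro θ hθ; exact ⟨hθ.1.1, hθ.2⟩
    · intro θ hθ; exact ⟨hθ.2, hθ.1.2⟩
    · have hn1 : ¬ ((5 / 2 : ℝ) ≤ (1 / 2 : ℝ)) := by norm_num
      have hn2 : ¬ ((5 / 2 : ℝ) ≤ (1 : ℝ)) := by norm_num
      have hn3 : ¬ ((5 / 2 : ℝ) ≤ (3 / 2 : ℝ)) := by norm_num
      have hn4 : ¬ ((5 / 2 : ℝ) ≤ (7 / 4 : ℝ)) := by norm_num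
      have hn5 : ¬ ((5 / 2 : ℝ) ≤ (2 : ℝ)) := by norm_num
      simp only [hn1, hn2, hn3, hn4, hn5, if_false]
      exact ss25525_junction56
  have g7 : SAlpha.EnergyDominatesOn (5 / 2) (21 / 4) (fun θ => if θ ≤ (3 : ℝ) then (if θ ≤ (5 / 2 : ℝ) then (if θ ≤ (2 : ℝ) then (if θ ≤ (7 / 4 : ℝ) then (if θ ≤ (3 / 2 : ℝ) then (if θ ≤ (1 : ℝ) then (if θ ≤ (1 / 2 : ℝ) then ((SAlpha.amplitudePhase (5 / 2) (21 / 4) (Poly.eval H0) (Poly.eval (Poly.deriv H0))) θ) else (SAlpha.amplitudePhase (5 / 2) (21 / 4) (Poly.eval H1) (Poly.eval (Poly.deriv H1))) θ) else (SAlpha.amplitudePhase (5 / 2) (21 / 4) (Poly.eval H2) (Poly.eval (Poly.deriv H2))) θ) else (SAlpha.amplitudePhase (5 / 2) (21 / 4) (Poly.eval H3) (Poly.eval (Poly.deriv H3))) θ) else (SAlpha.amplitudePhase (5 / 2) (21 / 4) (Poly.eval H4) (Poly.eval (Poly.deriv H4))) θ) else (SAlpha.amplitudePhase (5 / 2) (21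 / 4) (Poly.eval H5) (Poly.eval (Poly.deriv H5))) θ) else (SAlpha.amplitudePhase (5 / 2) (21 / 4) (Poly.eval H6) (Poly.eval (Poly.deriv H6))) θ) else (SAlpha.amplitudePhase (5 / 2) (21 / 4) (Poly.eval H7) (Poly.eval (Poly.deriv H7))) θ) (Icc 0 (4 : ℝ)) := by
    refine SAlpha.EnergyDominatesOn.glue (g6.mono ?_) (h7.mono ?_) ?_
    · intro θ hθ; exact ⟨hθ.1.1, hθ.2⟩
    · intro θ hθ; exact ⟨hθ.2, hθ.1.2⟩
    · have hn1 : ¬ ((3 : ℝ) ≤ (1 / 2 : ℝ)) := by norm_num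
      have hn2 : ¬ ((3 : ℝ) ≤ (1 : ℝ)) := by norm_num
      have hn3 : ¬ ((3 : ℝ) ≤ (3 / 2 : ℝ)) := by norm_num
      have hn4 : ¬ ((3 : ℝ) ≤ (7 / 4 : ℝ)) := by norm_num
      have hn5 : ¬ ((3 : ℝ) ≤ (2 : ℝ)) := by norm_num
      have hn6 : ¬ ((3 : ℝ) ≤ (5 / 2 : ℝ)) := by norm_num
      simp only [hn1, hn2, hn3, hn4, hn5, hn6, if_false]
      exact ss25525_junction67
  have g8 : SAlpha.EnergyDominatesOn (5 / 2) (21 / 4) (fun θ => if θ ≤ (4 : ℝ) then (if θ ≤ (3 : ℝ) then (if θ ≤ (5 / 2 : ℝ) then (if θ ≤ (2 : ℝ) then (if θ ≤ (7 / 4 : ℝ) then (if θ ≤ (3 / 2 : ℝ) then (if θ ≤ (1 : ℝ) then (if θ ≤ (1 / 2 : ℝ) then ((SAlpha.amplitudePhase (5 / 2) (21 / 4) (Poly.eval H0) (Poly.eval (Poly.deriv H0))) θ) else (SAlpha.amplitudePhase (5 / 2) (21 / 4) (Poly.eval H1) (Poly.eval (Poly.deriv H1))) θ) else (SAlpha.amplitudePhase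 (5 / 2) (21 / 4) (Poly.eval H2) (Poly.eval (Poly.deriv H2))) θ) else (SAlpha.amplitudePhase (5 / 2) (21 / 4) (Poly.eval H3) (Poly.eval (Poly.deriv H3))) θ) else (SAlpha.amplitudePhase (5 / 2) (21 / 4) (Poly.eval H4) (Poly.eval (Poly.deriv H4))) θ) else (SAlpha.amplitudePhase (5 / 2) (21 / 4) (Poly.eval H5) (Poly.eval (Poly.deriv H5))) θ) else (SAlpha.amplitudePhase (5 / 2) (21 / 4) (Poly.eval H6) (Poly.eval (Poly.deriv H6))) θ) else (SAlpha.amplitudePhase (5 / 2) (21 / 4) (Poly.eval H7) (Poly.eval (Poly.deriv H7))) θ) else (SAlpha.amplitudePhase (5 / 2) (21 / 4) (Poly.eval H8) (Poly.eval (Poly.deriv H8))) θ) (Icc 0 (6 : ℝ)) := by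
    refine SAlpha.EnergyDominatesOn.glue (g7.mono ?_) (h8.mono ?_) ?_
    · intro θ hθ; exact ⟨hθ.1.1, hθ.2⟩
    · intro θ hθ; exact ⟨hθ.2, hθ.1.2⟩
    · have hn1 : ¬ ((4 : ℝ) ≤ (1 / 2 : ℝ)) := by norm_num
      have hn2 : ¬ ((4 : ℝ) ≤ (1 : ℝ)) := by norm_num
      have hn3 : ¬ ((4 : ℝ) ≤ (3 / 2 : ℝ)) := by norm_num
      have hn4 : ¬ ((4 : ℝ) ≤ (7 / 4 : ℝ)) := by norm_num
      have hn5 : ¬ ((4 : ℝ) ≤ (2 : ℝ)) := by norm_num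
      have hn6 : ¬ ((4 : ℝ) ≤ (5 / 2 : ℝ)) := by norm_num
      have hn7 : ¬ ((4 : ℝ) ≤ (3 : ℝ)) := by norm_num
      simp only [hn1, hn2, hn3, hn4, hn5, hn6, hn7, if_false]
      exact ss25525_junction78
  have g9 : SAlpha.EnergyDominatesOn (5 / 2) (21 / 4) (fun θ => if θ ≤ (6 : ℝ) then (if θ ≤ (4 : ℝ) then (if θ ≤ (3 : ℝ) then (if θ ≤ (5 / 2 : ℝ) then (if θ ≤ (2 : ℝ) then (if θ ≤ (7 / 4 : ℝ) then (if θ ≤ (3 / 2 : ℝ) then (if θ ≤ (1 : ℝ) then (if θ ≤ (1 / 2 : ℝ) then ((SAlpha.amplitudePhase (5 / 2) (21 / 4) (Poly.eval H0) (Poly.eval (Poly.deriv H0))) θ) else (SAlpha.amplitudePhase (5 / 2) (21 / 4) (Poly.eval H1) (Poly.eval (Poly.deriv H1))) θ) else (SAlpha.amplitudePhase (5 / 2) (21 / 4) (Poly.eval H2) (Poly.eval (Poly.deriv H2))) θ) else (SAlpha.amplitudePhase (5 / 2) (21 / 4) (Poly.eval H3) (Poly.eval (Poly.deriv H3))) θ)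 else (SAlpha.amplitudePhase (5 / 2) (21 / 4) (Poly.eval H4) (Poly.eval (Poly.deriv H4))) θ) else (SAlpha.amplitudePhase (5 / 2) (21 / 4) (Poly.eval H5) (Poly.eval (Poly.deriv H5))) θ) else (SAlpha.amplitudePhase (5 / 2) (21 / 4) (Poly.eval H6) (Poly.eval (Poly.deriv H6))) θ) else (SAlpha.amplitudePhase (5 / 2) (21 / 4) (Poly.eval H7) (Poly.eval (Poly.deriv H7))) θ) else (SAlpha.amplitudePhase (5 / 2) (21 / 4) (Poly.eval H8) (Poly.eval (Poly.deriv H8))) θ) else (SAlpha.amplitudePhase (5 / 2) (21 / 4) (Poly.eval H9) (Poly.eval (Poly.deriv H9))) θ) (Icc 0 (10 : ℝ)) := by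
    refine SAlpha.EnergyDominatesOn.glue (g8.mono ?_) (h9.mono ?_) ?_
    · intro θ hθ; exact ⟨hθ.1.1, hθ.2⟩
    · intro θ hθ; exact ⟨hθ.2, hθ.1.2⟩
    · have hn1 : ¬ ((6 : ℝ) ≤ (1 / 2 : ℝ)) := by norm_num
      have hn2 : ¬ ((6 : ℝ) ≤ (1 : ℝ)) := by norm_num
      have hn3 : ¬ ((6 : ℝ) ≤ (3 / 2 : ℝ)) := by norm_num
      have hn4 : ¬ ((6 : ℝ) ≤ (7 / 4 : ℝ)) := by norm_num
      have hn5 : ¬ ((6 : ℝ) ≤ (2 : ℝ)) := by norm_num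
      have hn6 : ¬ ((6 : ℝ) ≤ (5 / 2 : ℝ)) := by norm_num
      have hn7 : ¬ ((6 : ℝ) ≤ (3 : ℝ)) := by norm_num
      have hn8 : ¬ ((6 : ℝ) ≤ (4 : ℝ)) := by norm_num
      simp only [hn1, hn2, hn3, hn4, hn5, hn6, hn7, hn8, if_false]
      exact ss25525_junction89
  have g10 : SAlpha.EnergyDominatesOn (5 / 2) (21 / 4) (fun θ => if θ ≤ (10 : ℝ) then (if θ ≤ (6 : ℝ) then (if θ ≤ (4 : ℝ) then (if θ ≤ (3 : ℝ) then (if θ ≤ (5 / 2 : ℝ) then (if θ ≤ (2 : ℝ) then (if θ ≤ (7 / 4 : ℝ) then (if θ ≤ (3 / 2 : ℝ) then (if θ ≤ (1 : ℝ) then (if θ ≤ (1 / 2 : ℝ) then ((SAlpha.amplitudePhase (5 / 2) (21 / 4) (Poly.eval H0) (Poly.eval (Poly.deriv H0))) θ) else (SAlpha.amplitudePhase (5 / 2) (21 / 4) (Poly.eval H1) (Poly.eval (Poly.deriv H1))) θ) else (SAlpha.amplitudePhase (5 / 2) (21 / 4) (Poly.eval H2) (Poly.eval (Poly.deriv H2)))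 θ) else (SAlpha.amplitudePhase (5 / 2) (21 / 4) (Poly.eval H3) (Poly.eval (Poly.deriv H3))) θ) else (SAlpha.amplitudePhase (5 / 2) (21 / 4) (Poly.eval H4) (Poly.eval (Poly.deriv H4))) θ) else (SAlpha.amplitudePhase (5 / 2) (21 / 4) (Poly.eval H5) (Poly.eval (Poly.deriv H5))) θ) else (SAlpha.amplitudePhase (5 / 2) (21 / 4) (Poly.eval H6) (Poly.eval (Poly.deriv H6))) θ) else (SAlpha.amplitudePhase (5 / 2) (21 / 4) (Poly.eval H7) (Poly.eval (Poly.deriv H7))) θ) else (SAlpha.amplitudePhase (5 / 2) (21 / 4) (Poly.eval H8) (Poly.eval (Poly.deriv H8))) θ) else (SAlpha.amplitudePhase (5 / 2) (21 / 4) (Poly.eval H9) (Poly.eval (Poly.deriv H9))) θ) else (SAlpha.amplitudePhase (5 / 2) (21 / 4) (Poly.eval H10) (Poly.eval (Poly.deriv H10))) θ) (Icc 0 (14 : ℝ)) := by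
    refine SAlpha.EnergyDominatesOn.glue (g9.mono ?_) (h10.mono ?_) ?_
    · intro θ hθ; exact ⟨hθ.1.1, hθ.2⟩
    · intro θ hθ; exact ⟨hθ.2, hθ.1.2⟩
    · have hn1 : ¬ ((10 : ℝ) ≤ (1 / 2 : ℝ)) := by norm_num
      have hn2 : ¬ ((10 : ℝ) ≤ (1 : ℝ)) := by norm_num
      have hn3 : ¬ ((10 : ℝ) ≤ (3 / 2 : ℝ)) := by norm_num
      have hn4 : ¬ ((10 : ℝ) ≤ (7 / 4 : ℝ)) := by norm_num
      have hn5 : ¬ ((10 : ℝ) ≤ (2 : ℝ)) := by norm_num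
      have hn6 : ¬ ((10 : ℝ) ≤ (5 / 2 : ℝ)) := by norm_num
      have hn7 : ¬ ((10 : ℝ) ≤ (3 : ℝ)) := by norm_num
      have hn8 : ¬ ((10 : ℝ) ≤ (4 : ℝ)) := by norm_num
      have hn9 : ¬ ((10 : ℝ) ≤ (6 : ℝ)) := by norm_num
      simp only [hn1, hn2, hn3, hn4, hn5, hn6, hn7, hn8, hn9, if_false]
      exact ss25525_junction910
  have g11 : SAlpha.EnergyDominatesOn (5 / 2) (21 / 4) (fun θ => if θ ≤ (14 : ℝ) then (if θ ≤ (10 : ℝ) then (if θ ≤ (6 : ℝ) then (if θ ≤ (4 : ℝ) then (if θ ≤ (3 : ℝ) then (if θ ≤ (5 / 2 : ℝ) then (if θ ≤ (2 : ℝ) then (if θ ≤ (7 / 4 : ℝ) then (if θ ≤ (3 / 2 : ℝ) then (if θ ≤ (1 : ℝ) then (if θ ≤ (1 / 2 : ℝ) then ((SAlpha.amplitudePhase (5 / 2) (21 / 4) (Poly.eval H0) (Poly.eval (Poly.deriv H0))) θ) else (SAlpha.amplitudePhase (5 / 2) (21 / 4) (Poly.eval H1) (Poly.eval (Poly.deriv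 H1))) θ) else (SAlpha.amplitudePhase (5 / 2) (21 / 4) (Poly.eval H2) (Poly.eval (Poly.deriv H2))) θ) else (SAlpha.amplitudePhase (5 / 2) (21 / 4) (Poly.eval H3) (Poly.eval (Poly.deriv H3))) θ) else (SAlpha.amplitudePhase (5 / 2) (21 / 4) (Poly.eval H4) (Poly.eval (Poly.deriv H4))) θ) else (SAlpha.amplitudePhase (5 / 2) (21 / 4) (Poly.eval H5) (Poly.eval (Poly.deriv H5))) θ) else (SAlpha.amplitudePhase (5 / 2) (21 / 4) (Poly.eval H6) (Poly.eval (Poly.deriv H6))) θ) else (SAlpha.amplitudePhase (5 / 2) (21 / 4) (Poly.eval H7) (Poly.eval (Poly.deriv H7))) θ) else (SAlpha.amplitudePhase (5 / 2) (21 / 4) (Poly.eval H8) (Poly.eval (Poly.deriv H8))) θ) else (SAlpha.amplitudePhase (5 / 2) (21 / 4) (Poly.eval H9) (Poly.eval (Poly.deriv H9))) θ) else (SAlpha.amplitudePhase (5 / 2) (21 / 4) (Poly.eval H10) (Poly.eval (Poly.deriv H10))) θ) else (SAlpha.amplitudePhase (5 / 2) (21 / 4) (Poly.eval H11) (Poly.eval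 (Poly.deriv H11))) θ) (Icc 0 (17 : ℝ)) := by
    refine SAlpha.EnergyDominatesOn.glue (g10.mono ?_) (h11.mono ?_) ?_
    · intro θ hθ; exact ⟨hθ.1.1, hθ.2⟩
    · intro θ hθ; exact ⟨hθ.2, hθ.1.2⟩
    · have hn1 : ¬ ((14 : ℝ) ≤ (1 / 2 : ℝ)) := by norm_num
      have hn2 : ¬ ((14 : ℝ) ≤ (1 : ℝ)) := by norm_num
      have hn3 : ¬ ((14 : ℝ) ≤ (3 / 2 : ℝ)) := by norm_num
      have hn4 : ¬ ((14 : ℝ) ≤ (7 / 4 : ℝ)) := by norm_num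
      have hn5 : ¬ ((14 : ℝ) ≤ (2 : ℝ)) := by norm_num
      have hn6 : ¬ ((14 : ℝ) ≤ (5 / 2 : ℝ)) := by norm_num
      have hn7 : ¬ ((14 : ℝ) ≤ (3 : ℝ)) := by norm_num
      have hn8 : ¬ ((14 : ℝ) ≤ (4 : ℝ)) := by norm_num
      have hn9 : ¬ ((14 : ℝ) ≤ (6 : ℝ)) := by norm_num
      have hn10 : ¬ ((14 : ℝ) ≤ (10 : ℝ)) := by norm_num
      simp only [hn1, hn2, hn3, hn4, hn5, hn6, hn7, hn8, hn9, hn10, if_false]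
      exact ss25525_junction1011
  have g12 : SAlpha.EnergyDominatesOn (5 / 2) (21 / 4) (fun θ => if θ ≤ (17 : ℝ) then (if θ ≤ (14 : ℝ) then (if θ ≤ (10 : ℝ) then (if θ ≤ (6 : ℝ) then (if θ ≤ (4 : ℝ) then (if θ ≤ (3 : ℝ) then (if θ ≤ (5 / 2 : ℝ) then (if θ ≤ (2 : ℝ) then (if θ ≤ (7 / 4 : ℝ) then (if θ ≤ (3 / 2 : ℝ) then (if θ ≤ (1 : ℝ) then (if θ ≤ (1 / 2 : ℝ) then ((SAlpha.amplitudePhase (5 / 2) (21 / 4) (Poly.eval H0) (Poly.eval (Poly.deriv H0))) θ) else (SAlpha.amplitudePhase (5 / 2) (21 / 4) (Poly.eval H1) (Poly.eval (Poly.deriv H1))) θ) else (SAlpha.amplitudePhase (5 / 2) (21 / 4) (Poly.eval H2) (Poly.eval (Poly.deriv H2))) θ) else (SAlpha.amplitudePhase (5 / 2) (21 / 4) (Poly.eval H3) (Poly.eval (Poly.deriv H3))) θ) else (SAlpha.amplitudePhase (5 / 2) (21 / 4) (Poly.eval H4) (Poly.eval (Poly.deriv H4))) θ) else (SAlpha.amplitudePhase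 (5 / 2) (21 / 4) (Poly.eval H5) (Poly.eval (Poly.deriv H5))) θ) else (SAlpha.amplitudePhase (5 / 2) (21 / 4) (Poly.eval H6) (Poly.eval (Poly.deriv H6))) θ) else (SAlpha.amplitudePhase (5 / 2) (21 / 4) (Poly.eval H7) (Poly.eval (Poly.deriv H7))) θ) else (SAlpha.amplitudePhase (5 / 2) (21 / 4) (Poly.eval H8) (Poly.eval (Poly.deriv H8))) θ) else (SAlpha.amplitudePhase (5 / 2) (21 / 4) (Poly.eval H9) (Poly.eval (Poly.deriv H9))) θ) else (SAlpha.amplitudePhase (5 / 2) (21 / 4) (Poly.eval H10) (Poly.eval (Poly.deriv H10))) θ) else (SAlpha.amplitudePhase (5 / 2) (21 / 4) (Poly.eval H11) (Poly.eval (Poly.deriv H11))) θ) else (SAlpha.amplitudePhase (5 / 2) (21 / 4) (Poly.eval H12) (Poly.eval (Poly.deriv H12))) θ) (Icc 0 (20 : ℝ)) := by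
    refine SAlpha.EnergyDominatesOn.glue (g11.mono ?_) (h12.mono ?_) ?_
    · intro θ hθ; exact ⟨hθ.1.1, hθ.2⟩
    · intro θ hθ; exact ⟨hθ.2, hθ.1.2⟩
    · have hn1 : ¬ ((17 : ℝ) ≤ (1 / 2 : ℝ)) := by norm_num
      have hn2 : ¬ ((17 : ℝ) ≤ (1 : ℝ)) := by norm_num
      have hn3 : ¬ ((17 : ℝ) ≤ (3 / 2 : ℝ)) := by norm_num
      have hn4 : ¬ ((17 : ℝ) ≤ (7 / 4 : ℝ)) := by norm_num
      have hn5 : ¬ ((17 : ℝ) ≤ (2 : ℝ)) := by norm_num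
      have hn6 : ¬ ((17 : ℝ) ≤ (5 / 2 : ℝ)) := by norm_num
      have hn7 : ¬ ((17 : ℝ) ≤ (3 : ℝ)) := by norm_num
      have hn8 : ¬ ((17 : ℝ) ≤ (4 : ℝ)) := by norm_num
      have hn9 : ¬ ((17 : ℝ) ≤ (6 : ℝ)) := by norm_num
      have hn10 : ¬ ((17 : ℝ) ≤ (10 : ℝ)) := by norm_num
      have hn11 : ¬ ((17 : ℝ) ≤ (14 : ℝ)) := by norm_num
      simp only [hn1, hn2, hn3, hn4, hn5, hn6, hn7, hn8, hn9, hn10, hn11, if_false]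
      exact ss25525_junction1112
  refine SAlpha.EnergyDominatesOn.glue (g12.mono ?_) (h13.mono ?_) ?_
  · intro θ hθ; exact ⟨hθ.1.1, hθ.2⟩
  · intro θ hθ; exact ⟨hθ.2, hθ.1.2⟩
  · have hn1 : ¬ ((20 : ℝ) ≤ (1 / 2 : ℝ)) := by norm_num
    have hn2 : ¬ ((20 : ℝ) ≤ (1 : ℝ)) := by norm_num
    have hn3 : ¬ ((20 : ℝ) ≤ (3 / 2 : ℝ)) := by norm_num
    have hn4 : ¬ ((20 : ℝ) ≤ (7 / 4 : ℝ)) := by norm_num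
    have hn5 : ¬ ((20 : ℝ) ≤ (2 : ℝ)) := by norm_num
    have hn6 : ¬ ((20 : ℝ) ≤ (5 / 2 : ℝ)) := by norm_num
    have hn7 : ¬ ((20 : ℝ) ≤ (3 : ℝ)) := by norm_num
    have hn8 : ¬ ((20 : ℝ) ≤ (4 : ℝ)) := by norm_num
    have hn9 : ¬ ((20 : ℝ) ≤ (6 : ℝ)) := by norm_num
    have hn10 : ¬ ((20 : ℝ) ≤ (10 : ℝ)) := by norm_num
    have hn11 : ¬ ((20 : ℝ) ≤ (14 : ℝ)) := by norm_num
    have hn12 : ¬ ((20 : ℝ) ≤ (17 : ℝ)) := by norm_num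
    simp only [hn1, hn2, hn3, hn4, hn5, hn6, hn7, hn8, hn9, hn10, hn11, hn12, if_false]
    exact ss25525_junction1213

/-- **THE ROW: `(s, α) = ((5 / 2), 21/4)` IS ON THE STABLE SIDE OF THE `s–α` MODEL** — no window carries an `SAlpha.UnstableWitness`
(glued polynomial core on `[−24, 24]` by reflection, lit-4's explicit tail amplitude `(1 − c/θ)(1 + α cos θ/θ²)`, `c = 8`, beyond).
MODEL `s–α`; «stable» in the model's own one-surface (Newcomb) sense; nothing about a device. [instance data] -/
theorem stableSide_fiveHalves_525 : SAlpha.StableSide (5 / 2) (21 / 4) := by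
  have hcore := ss25525_dominates_core
  have htail := SAlpha.energyDominatesOn_tail (s := (5 / 2)) (α := 21 / 4) (c := 8) (T := 24)
    (by norm_num) (by norm_num) (by norm_num) (by norm_num) (by norm_num) ss25525_tailBound_nonneg
  refine SAlpha.stableSide_of_core_tail (by norm_num) hcore ?_ htail ?_
  · simp only [show ((0:ℝ) ≤ (1 / 2 : ℝ)) from by norm_num, show ((0:ℝ) ≤ (1 : ℝ)) from by norm_num, show ((0:ℝ) ≤ (3 / 2 : ℝ)) from by norm_num, show ((0:ℝ) ≤ (7 / 4 : ℝ)) from by norm_num, show ((0:ℝ) ≤ (2 : ℝ)) from by norm_num, show ((0:ℝ) ≤ (5 / 2 : ℝ)) from by norm_num, show ((0:ℝ) ≤ (3 : ℝ)) from by norm_num, show ((0:ℝ) ≤ (4 : ℝ)) from by norm_num, show ((0:ℝ) ≤ (6 : ℝ)) from by norm_num, show ((0:ℝ) ≤ (10 : ℝ)) from by norm_num, show ((0:ℝ) ≤ (14 : ℝ)) from by norm_num, show ((0:ℝ) ≤ (17 : ℝ)) from by norm_num, show ((0:ℝ) ≤ (20 : ℝ)) from by norm_num, if_true]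
    exact (SAlpha.amplitudePhase_zero_of_deriv_zero H0d_at_zero.symm).le
  · have ht0 : ¬ ((24 : ℝ) ≤ (1 / 2 : ℝ)) := by norm_num
    have ht1 : ¬ ((24 : ℝ) ≤ (1 : ℝ)) := by norm_num
    have ht2 : ¬ ((24 : ℝ) ≤ (3 / 2 : ℝ)) := by norm_num
    have ht3 : ¬ ((24 : ℝ) ≤ (7 / 4 : ℝ)) := by norm_num
    have ht4 : ¬ ((24 : ℝ) ≤ (2 : ℝ)) := by norm_num
    have ht5 : ¬ ((24 : ℝ) ≤ (5 / 2 : ℝ)) := by norm_num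
    have ht6 : ¬ ((24 : ℝ) ≤ (3 : ℝ)) := by norm_num
    have ht7 : ¬ ((24 : ℝ) ≤ (4 : ℝ)) := by norm_num
    have ht8 : ¬ ((24 : ℝ) ≤ (6 : ℝ)) := by norm_num
    have ht9 : ¬ ((24 : ℝ) ≤ (10 : ℝ)) := by norm_num
    have ht10 : ¬ ((24 : ℝ) ≤ (14 : ℝ)) := by norm_num
    have ht11 : ¬ ((24 : ℝ) ≤ (17 : ℝ)) := by norm_num
    have ht12 : ¬ ((24 : ℝ) ≤ (20 : ℝ)) := by norm_num
    simp only [ht0, ht1, ht2, ht3, ht4, ht5, ht6, ht7, ht8, ht9, ht10, ht11, ht12, if_false]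
    rw [SAlpha.amplitudePhase_le_iff]
    exact (SAlpha.tail_logDeriv_le (s := (5 / 2)) (α := 21 / 4) (c := 8) (T := 24)
      (by norm_num) (by norm_num) (by norm_num) (by norm_num) (by norm_num)).trans ss25525_junction_tail

/-- Corollary in lit-3's words: at `(s, α) = ((5 / 2), 21/4)` there is no `SAlpha.UnstableWitness` on ANY window. [instance data] -/
theorem not_unstableWitness_fiveHalves_525 (a b : ℝ) (X X' : ℝ → ℝ) :
    ¬ SAlpha.UnstableWitness (5 / 2) (21 / 4) a b X X' :=
  stableSide_fiveHalves_525 a b X X'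

end SAlphaSecondStableS25A525

end Summit.Ventures.FusionMHD.Models
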